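import Summits.BirchSwinnertonDyer.BirchSwinnertonDyer.Theorems.PrintX8VSCSharpFlatMainConjectureContraOfBSDpRankZero
import Summits.BirchSwinnertonDyer.BirchSwinnertonDyer.Theorems.SignedLowerHalvesSprungLowerDivisibilityAtThreeSqueezeToCommonZerosContra
import Literature.NumberTheory.EllipticCurves.SkinnerUrban2014.CharacteristicIdealBaseChangeProofs
import Literature.NumberTheory.EllipticCurves.IwasawaAlgebraRankOneIdealProofs
import Literature.NumberTheory.EllipticCurves.IwasawaEulerCharProofs
import HarnessLib

/-!
# Corner X8 (`p = 3`, `a₃ = ±3`), analytic rank `0`, ANY `3`-adic image, PRINT keying: `BSD(E,3)` at the pair — in particular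
# `3 ∤ #Ш_an` (unit cells) — gives KATO'S MAIN CONJECTURE 12.10 IN LENGTH FORM at every height-one prime and the two
# inequalities the research cruxes K′ (23732) / C′ (23733, THEOREM-B colour) display, AT THAT PAIR
# (cell `bsd-print-x8`, prover seat p2 gen 7, sequel to `X8KatoConverseContra` (p681647); route `PrintX8VSC`; `--supports` item 23742
# as a helper; closes nothing)

PARTITION: per-pair and class theorems CONDITIONAL on PUBLISHED named facts only; closes NONE; 0 census cells move; BSD, K′, C′,
MC′ (class-wide) and the leaf X8 are NOT proved by any of this.

## What this file does (composition of two landed files, nothing else)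

`X8KatoConverseContra` (p2 g7, p681647) §1/§3: at an X8 pair of analytic rank `0` with `BSDp W 3` (e.g. a unit cell, `ord₃ #Ш_an ≤ 0`,
gen 4 p677031), Sprung's Main Conj. 7.21 in PRINT keying holds for every `γ⁻¹`-keyed dual of every unit-content colour `•₀` (THEOREM B:
such a colour exists on every X8 pair). `PrintX8VSCOfMainConjecture721` (p3 g7, p679782) §1/§2, POINTWISE: Main Conj. 7.21′ for ONE
datum of a colour with `L^• ≠ 0`, together with a contragredient ♯/♭ Coleman–Kato package `C` of that colour over Kato's pinned `𝐇¹`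
(`SharpFlatColemanKatoDataContra`, Sprung 2012 Def. 6.1 / Thm. 7.14 (3) / Kato 12.6 in print keying), gives Kato's Conj. 12.10 in
length form `ℓ_𝔭(𝐇¹ ⧸ C.Z) = ℓ_𝔭 Y′.X` for EVERY `γ⁻¹`-keyed fine datum `Y′` at EVERY height-one `𝔭` (four-term identity
`SharpFlatColemanKatoDataContra.lengthAt_add_eq`, LEAD g6), and the C′ inequality `ℓ_𝔭 Λ/(G) ≤ ℓ_𝔭 D.X`. Composed:

* §1 `X8.katoFineLengthAt_eq_of_bsdp_of_hasUnitContent_of_analyticRank_eq_zero` — PER PAIR, ANY image: X8 ∧ `r_an = 0` ∧ `BSDp W 3`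
  ⟹ for every frame, newform/period/Sprung pair, unit-content colour `•`, Kato datum `I`, package `C` of colour `•` over `I`, every
  fine datum `Y′` (key `γ⁻¹`) and height-one `𝔭`: `ℓ_𝔭(I.H ⧸ C.Z) = ℓ_𝔭 Y′.X` — Kato's Main Conjecture 12.10 (length form) AT THE PAIR.
* §2 `X8.katoFineLengthAt_le_joint_of_bsdp_of_analyticRank_eq_zero` — the EXACT conclusion shape of crux K′
  (`PrintX8VSC.KatoFineLowerSporadicGivenHeldX8Contra`, item 23732) at the pair, for the JOINT packages `Cs`, `Cf` with `Cs.Z = Cf.Z`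
  and NO colour hypothesis (THEOREM B chooses `•₀` inside; case split ♯/♭ as in p3 g7 §3): `ℓ_𝔭(I.H ⧸ Cs.Z) ≤ ℓ_𝔭 Y′.X` at every
  height-one `𝔭` — K′'s side conditions (`p ∉ 𝔭`, no `ω̃ₙ`, common zero) not even used.
* §3 `X8.lengthAt_quotient_span_le_of_bsdp_of_hasUnitContent_of_analyticRank_eq_zero` — the conclusion shape of crux C′
  (`PrintX8VSC.CyclotomicLowerPosLevelGivenHeldX8Contra`, item 23733) at the pair for the unit-content colour: `ℓ_𝔭 Λ/(G) ≤ ℓ_𝔭 D.X`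
  for every Néron-normalised `G` and every print-keyed dual `D` of `Sel^{•₀}`, at every height-one `𝔭`.
* §4 UNIT-CELL form of §2 (`ord₃ #Ш_an ≤ 0` instead of `BSDp`, adding `hmodf`, `h22`; §3's unit-cell form is the same one-line
  composition with gen 4's `X8.bsdp_of_shaAn_le_…`) and §5 the CLASS form
  `X8.katoFineLowerSporadic_rankZero_of_bsdp_rankZero`: the rank-zero half of the leaf ⟹ K′'s conclusion at every rank-zero X8 pair.

READING FOR THE CRUX CHAIN (LEAD 19875 / cdisprove / pen). A `stub-false` witness against K′'s residue stub, or against C′'s for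
the THEOREM-B colour, CANNOT come from a rank-zero X8 pair at which `BSD(E,3)` is settled — in particular from none of the 54 unit
rank-zero census cells (all of image `C_ns⁺(3)`; labels in HOME/P2-G7-CONVERSE-CONTRA.md) — modulo the displayed published facts:
there Kato's 12.10 holds with EQUALITY at every height-one prime. The research content of K′/C′ lives on {`r_an = 0`, `3 ∣ #Ш_an`,
BSD₃ open} ∪ {`r_an ≥ 1`} (and, for C′, on the non-unit-content colour). Rank one is not touched (seat notes g5/g6).

HONEST STATUS. Conditional on the displayed named facts (all PUBLISHED; `h59`, `h22` tree theorems); THEOREM B / Wuthrich L20 enter as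
kernel theorems; the packages `I`, `C`, `Cs`, `Cf` are DATA (binders), exactly as in the cruxes. ROUTE-INDEPENDENT (no Theses import:
p3 g7's pointwise §1/§2 live in a module importing the route file, so their 15-line proofs are re-run here PRIVATELY on LEAD g6's
four-term identity — statements public only in p3's file; nothing of p3's is restated publicly). beyond-print theorem: YES
(modest; same basis as p681647: Kato's Conj. 12.10 in length form for individual curves with `a₃ = ±3`, `r_an = 0`, `3 ∤ #Ш_an` and
non-surjective mod-`3` image is not in print — Kato Thm. 12.5 (4) needs (12.5.2); presearch recorded in p681647's docstring).

References: [Kato2004Asterisque] Conj. 12.10 (p. 224), Thm. 12.5 (p. 222), §17.13 (p. 280); [Sprung2012] Def. 6.1, Thm. 7.14 (3), Thm.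
7.16, Prop. 7.19, Main Conj. 7.21 (pp. 1495–1505); [Sprung2024] §5.2; [SkinnerUrban2014] §3.1.6; [GreenbergLNM1716] §4; [Miller2011LMS]
Def. 1.1; tree: p681647 (p2 g7), p679782 (p3 g7), p677031 (p2 g4), LEAD g6 `…SqueezeToCommonZerosContra`.
-/

set_option autoImplicit false
-- justification: the mandated namespace `Summit.BirchSwinnertonDyer.BirchSwinnertonDyer.Theorems` repeats a segment (D-0017).
set_option linter.dupNamespace false

noncomputable section
open scoped Classical NumberField MatrixGroups ModularForm

open NumberField IsDedekindDomain WeierstrassCurve CongruenceSubgroup Field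
  Literature.NumberTheory.EllipticCurves Literature.NumberTheory.EllipticCurves.ModularForms
  Literature.NumberTheory.EllipticCurves.Rank1Residual
  Literature.NumberTheory.EllipticCurves.Rank1Residual.Typed
  Literature.NumberTheory.EllipticCurves.Sprung2017 Literature.NumberTheory.EllipticCurves.Sprung2012
  Literature.NumberTheory.EllipticCurves.Sprung2024
  Literature.NumberTheory.EllipticCurves.GreenbergVatsal2000
  Literature.NumberTheory.EllipticCurves.ZpExtension
  Literature.NumberTheory.EllipticCurves.IwasawaAlgebra
  Literature.NumberTheory.EllipticCurves.Kato2004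
  Summit.BirchSwinnertonDyer.BirchSwinnertonDyer.Theorems
  Summit.BirchSwinnertonDyer.Rank1Residual.Supersingular

namespace Summit.BirchSwinnertonDyer.BirchSwinnertonDyer.Theorems.X8KatoConverseContraLength

/-! ### §0 Private `Λ`-algebra plumbing (p3 g7's pointwise Prop. 7.19 step, re-run route-independently) -/

/-- `Λ ⧸ (x)` is `Λ`-torsion for `x ≠ 0`. [folklore] -/
private theorem isTorsion_quotient_span {p : ℕ} [Fact p.Prime] {x : IwasawaAlgebra p} (hx : x ≠ 0) :
    Module.IsTorsion (IwasawaAlgebra p) (IwasawaAlgebra p ⧸ Ideal.span {x}) := by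
  intro q
  refine ⟨⟨x, mem_nonZeroDivisors_of_ne_zero hx⟩, ?_⟩
  induction q using Submodule.Quotient.induction_on with
  | H y =>
    rw [Submonoid.smul_def]
    change x • Submodule.Quotient.mk y = 0
    rw [← Submodule.Quotient.mk_smul, Submodule.Quotient.mk_eq_zero, smul_eq_mul]
    exact Ideal.mul_mem_right _ _ (Ideal.mem_span_singleton_self x)

/-- The characteristic ideal pins the height-one lengths: `char M = (x)` ⟹ `ℓ_𝔭 M = ℓ_𝔭 Λ/(x)`.
[cite: SkinnerUrban2014, §3.1.6 (p. 20)] [cite: Washington1997, §13.2] -/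
private theorem lengthAt_eq_quotient_span {p : ℕ} [Fact p.Prime] {M : Type*} [AddCommGroup M]
    [Module (IwasawaAlgebra p) M] [Module.Finite (IwasawaAlgebra p) M]
    (hM : Module.IsTorsion (IwasawaAlgebra p) M) {x : IwasawaAlgebra p}
    (hchar : Module.charIdeal (IwasawaAlgebra p) M = Ideal.span {x})
    (𝔭 : PrimeSpectrum (IwasawaAlgebra p)) (h𝔭 : 𝔭.asIdeal.height = 1) :
    Module.lengthAt (IwasawaAlgebra p) M 𝔭 =
      Module.lengthAt (IwasawaAlgebra p) (IwasawaAlgebra p ⧸ Ideal.span {x}) 𝔭 := by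
  have hx : x ≠ 0 := by
    rintro rfl
    apply Module.charIdeal_ne_bot (IwasawaAlgebra p) M
    rw [hchar, Ideal.span_singleton_eq_bot]
  exact SkinnerUrban2014.lengthAt_eq_of_charIdeal_eq hM (isTorsion_quotient_span hx)
    (hchar.trans (Module.charIdeal_quotient_span_singleton hx).symm) 𝔭 h𝔭

section Pointwise

variable (W : WeierstrassCurve ℚ) [W.IsElliptic] (p : ℕ) [Fact p.Prime]
  [ContinuousSMul ℤ_[p] (W.tateModule p)] [Module.Free ℤ_[p] (W.tateModule p)] [Module.Finite ℤ_[p] (W.tateModule p)]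
  {N : ℕ} {f : CuspForm (Gamma0 N) 2} {ϖ : ℚ} {κ : ZpExtension ℚ p} {γ : absoluteGaloisGroup ℚ}
  {E : Type} [Field E] [Algebra ℚ E] {ι : AlgebraicClosure ℚ →ₐ[ℚ] AlgebraicClosure E} {ap : ℤ}
  {g : absoluteGaloisGroup E} {c : ℕ → localPoints W E} {col : Chroma} {I : IwasawaH1Data W p κ γ}

/-- Sprung's Prop. 7.19, direction «Main Conj. 7.21′ for one print-keyed datum ⟹ Kato 12.10 in length form», pointwise at a
height-one `𝔭` (p3 g7 §1 re-run on LEAD g6's four-term identity `SharpFlatColemanKatoDataContra.lengthAt_add_eq`).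
[cite: Sprung2012, Thm. 7.14 (3) (p. 1504) and Prop. 7.19 (p. 1505)] [cite: Kato2004Asterisque, Conj. 12.10 (p. 224), §17.13 (p. 280)] -/
private theorem katoFineLengthAt_eq_of_charIdeal_eq
    (C : SharpFlatColemanKatoDataContra W p f ϖ κ γ ι ap g c col I)
    (hirr : W.HasIrreducibleModPGaloisRep p) {Lsharp Lflat : IwasawaAlgebra p}
    (hSP : IsSprungPair f p ap Lsharp Lflat) (hcol : chromaticL col Lsharp Lflat ≠ 0)
    (D : SharpFlatSelmerDualData W κ γ⁻¹ ι ap g c col) [Module.Finite (IwasawaAlgebra p) D.X]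
    (hDt : Module.IsTorsion (IwasawaAlgebra p) D.X) {gen : IwasawaAlgebra p}
    (hchar : D.charIdeal = Ideal.span {gen})
    (hgen : iwasawaToPowerSeries p gen =
      PowerSeries.C ((ϖ : ℚ) : ℚ_[p]) * iwasawaToPowerSeries p (chromaticL col Lsharp Lflat))
    (Y : W.FineSelmerDualData κ γ⁻¹) (𝔭 : PrimeSpectrum (IwasawaAlgebra p)) (h𝔭 : 𝔭.asIdeal.height = 1) :
    Module.lengthAt (IwasawaAlgebra p) (I.H ⧸ C.Z) 𝔭 = Module.lengthAt (IwasawaAlgebra p) Y.X 𝔭 := by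
  have hFT := C.lengthAt_add_eq W p hirr hSP hcol hgen D Y 𝔭 h𝔭
  have hD : Module.lengthAt (IwasawaAlgebra p) D.X 𝔭 =
      Module.lengthAt (IwasawaAlgebra p) (IwasawaAlgebra p ⧸ Ideal.span {gen}) 𝔭 :=
    lengthAt_eq_quotient_span hDt hchar 𝔭 h𝔭
  have hfin : Module.lengthAt (IwasawaAlgebra p) D.X 𝔭 ≠ ⊤ :=
    IwasawaAlgebra.lengthAt_ne_top_of_isTorsion D.X hDt 𝔭 h𝔭.le
  rw [← hD, add_comm (Module.lengthAt (IwasawaAlgebra p) Y.X 𝔭)] at hFT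
  exact WithTop.add_left_cancel hfin hFT

end Pointwise


section PerPair

variable (W : WeierstrassCurve ℚ) [W.IsElliptic] [W.IsGloballyMinimal] (p : ℕ) [Fact p.Prime]
  [ContinuousSMul ℤ_[p] (W.tateModule p)] [Module.Free ℤ_[p] (W.tateModule p)] [Module.Finite ℤ_[p] (W.tateModule p)]

/-! ### §1 `BSD(E,3)` at a rank-zero X8 pair ⟹ Kato's Conj. 12.10 in LENGTH FORM at every height-one prime (one package) -/

/-- **X8 ∧ `r_an = 0` ∧ `BSD(E,3)`, ANY image, PRINT keying ⟹ Kato's Main Conjecture 12.10 in length form AT THE PAIR.** For the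
frame `(κ, γ, v, g, cneg, c)`, the newform `f` with `ϖ·Ω_E = Ω⁺_f`, a Sprung pair, a colour `•` of UNIT CONTENT, any pinned Kato
`𝐇¹`-datum `I` and any contragredient ♯/♭ Coleman–Kato package `C` of colour `•` over `I`: for EVERY `γ⁻¹`-keyed fine datum `Y′`
and EVERY height-one `𝔭`, `ℓ_𝔭(I.H ⧸ C.Z) = ℓ_𝔭 Y′.X`. Proof: a print-keyed dual `D′` of `Sel^•(E/ℚ_∞)` exists
(`nonempty_sharpFlatSelmerDualData_rat`), is f.g. by Thm. 7.14 through the dictionary, satisfies Main Conj. 7.21′ by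
`X8KatoConverseContra` §1 (`BSDp` ⟹ MC′), and the pointwise Prop. 7.19 step (§0, p3 g7's argument on LEAD g6's four-term identity) concludes.
PER PAIR; conditional on the displayed facts; the package is a binder; closes nothing.
[cite: Kato2004Asterisque, Conj. 12.10 (p. 224) and §17.13 (p. 280)] [cite: Sprung2012, Thm. 7.14 (3) (p. 1504), Prop. 7.19 and Main Conj. 7.21 (p. 1505)]
[cite: Sprung2024, §5.2 Lemmas 5.5–5.9] [cite: GreenbergLNM1716, §4 (p. 103)] [cite: SkinnerUrban2014, §3.1.6 (p. 20)] -/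
theorem X8.katoFineLengthAt_eq_of_bsdp_of_hasUnitContent_of_analyticRank_eq_zero
    (h714 : thm714_sharpFlatSelmerDual_finite_torsion)
    (h716c : thm716_sharpFlatCharIdeal_divisibility_contra)
    (hCKc : thm714seq_sharpFlatColemanKato_zeta_contra)
    (h59 : lem59AllN_sharpFlatCharValue_rankZero)
    (h3 : realPeriodRat_eq_unit_mul_plusPeriod_three)
    (hGZK : rank_eq_analyticRank_of_analyticRank_le_one) (hmod : hasEntireLFunction_rat)
    (hX : ClassX8 W p) (h0 : W.analyticRank = 0) (hB : BSDp W p)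
    {κ : ZpExtension ℚ p} {γ : absoluteGaloisGroup ℚ} (hκ : κ.IsCyclotomic)
    (hγ : κ.IsTopGenerator γ) (hγ' : IsCyclotomicVariable p γ)
    {v : HeightOneSpectrum (𝓞 ℚ)} (hv : (p : 𝓞 ℚ) ∈ v.asIdeal)
    {g : absoluteGaloisGroup (v.adicCompletion ℚ)}
    (hg : κ.IsTopGenerator (resGalOfEmb (closureEmb (K := ℚ) (v.adicCompletion ℚ)) g))
    {cneg : localPoints W (v.adicCompletion ℚ)} {c : ℕ → localPoints W (v.adicCompletion ℚ)}
    (hc : IsHondaSystem κ (closureEmb (K := ℚ) (v.adicCompletion ℚ)) W (W.frobeniusTrace p) g cneg c)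
    {N : ℕ} [NeZero N] {f : CuspForm (Gamma0 N) 2} (hf : IsNewformOf W f)
    {ϖ : ℚ} (hϖ : (ϖ : ℝ) * W.realPeriodRat = plusPeriod f)
    {Lsharp Lflat : IwasawaAlgebra p} (hSP : IsSprungPair f p (W.frobeniusTrace p) Lsharp Lflat)
    (col : Chroma) (hu : HasUnitContent (chromaticL col Lsharp Lflat))
    (I : IwasawaH1Data W p κ γ)
    (C : SharpFlatColemanKatoDataContra W p f ϖ κ γ (closureEmb (K := ℚ) (v.adicCompletion ℚ))
      (W.frobeniusTrace p) g c col I)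
    (Y : W.FineSelmerDualData κ γ⁻¹) (𝔭 : PrimeSpectrum (IwasawaAlgebra p)) (h𝔭 : 𝔭.asIdeal.height = 1) :
    Module.lengthAt (IwasawaAlgebra p) (I.H ⧸ C.Z) 𝔭 = Module.lengthAt (IwasawaAlgebra p) Y.X 𝔭 := by
  have hp3 : p = 3 := hX.1
  subst hp3
  have hp2 : (3 : ℕ) ≠ 2 := by decide
  have hgood : W.HasGoodReductionAtPrime 3 := hX.2.1.1
  have hdvd : ((3 : ℕ) : ℤ) ∣ W.frobeniusTrace 3 := hX.2.1.2
  have hirr : W.HasIrreducibleModPGaloisRep 3 := ClassX8.irr W 3 hX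
  have hcol : chromaticL col Lsharp Lflat ≠ 0 :=
    Summit.BirchSwinnertonDyer.Rank1Residual.X11a.ne_zero_of_hasUnitContent hu
  -- a print-keyed dual `D′` of `Sel^•`, finitely generated by Thm. 7.14 through the dictionary
  obtain ⟨D'⟩ := nonempty_sharpFlatSelmerDualData_rat W κ γ⁻¹ v g c col
  let D₀ := sharpFlatSelmerDualData W κ (closureEmb (K := ℚ) (v.adicCompletion ℚ))
    (W.frobeniusTrace 3) g c col hγ
  obtain ⟨hfin₀, -⟩ :=
    h714 W 3 hp2 hgood hdvd f hf κ γ hκ hγ hγ' v hv g hg cneg c hc col Lsharp Lflat hSP hcol D₀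
  haveI := hfin₀
  haveI : Module.Finite (IwasawaAlgebra 3) D'.X := (sharpFlatSelmerDualData_finite_inv_iff D₀ D').1 hfin₀
  -- Main Conj. 7.21′ for `D′` from `BSD(E,3)` (p2 g7 §1), then Kato 12.10 in length form (p3 g7 §1)
  obtain ⟨hDt, gen, hchar, hgen⟩ :=
    X8KatoConverseContra.X8.sharpFlatCharIdeal_eq_contra_of_bsdp_of_hasUnitContent_of_analyticRank_eq_zero W 3 h714
      h716c hCKc h59 h3 hGZK hmod hX h0 hB hκ hγ hγ' hv hg hc hf hϖ hSP col hu D'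
  exact katoFineLengthAt_eq_of_charIdeal_eq W 3 C hirr hSP hcol D' hDt hchar hgen Y 𝔭 h𝔭

/-! ### §2 The conclusion shape of crux K′ (item 23732) AT a rank-zero pair with `BSD(E,3)`: joint packages, no colour hypothesis -/

/-- **X8 ∧ `r_an = 0` ∧ `BSD(E,3)`, ANY image ⟹ K′'s displayed inequality `ℓ_𝔭(I.H ⧸ Cs.Z) ≤ ℓ_𝔭 Y′.X` at EVERY height-one
`𝔭`, for the JOINT contragredient packages `Cs`, `Cf` (`Cs.Z = Cf.Z`) of the route's cruxes** — THEOREM B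
(`ClassX8.oneColourMuAn`, input-free) picks the unit-content colour `•₀`; §1 at the package of that colour (`Cs` if `•₀ = ♯`,
`Cf` with `Cs.Z = Cf.Z` if `•₀ = ♭`) gives EQUALITY, a fortiori `≤`. K′'s side conditions (`p ∉ 𝔭`, no `ω̃ₙ ∈ 𝔭`, common zero)
are not used. PER PAIR; conditional; closes nothing — K′ quantifies over ALL X8 pairs and is NOT proved.
[cite: Kato2004Asterisque, Conj. 12.10 (p. 224)] [cite: Sprung2012, Thm. 7.14 (3) (p. 1504), Prop. 7.19 and Main Conj. 7.21 (p. 1505)]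
[cite: Sprung2024, §5.2 Lemmas 5.5–5.9] [cite: GreenbergLNM1716, §4 (p. 103)] -/
theorem X8.katoFineLengthAt_le_joint_of_bsdp_of_analyticRank_eq_zero
    (h714 : thm714_sharpFlatSelmerDual_finite_torsion)
    (h716c : thm716_sharpFlatCharIdeal_divisibility_contra)
    (hCKc : thm714seq_sharpFlatColemanKato_zeta_contra)
    (h59 : lem59AllN_sharpFlatCharValue_rankZero)
    (h3 : realPeriodRat_eq_unit_mul_plusPeriod_three)
    (hGZK : rank_eq_analyticRank_of_analyticRank_le_one) (hmod : hasEntireLFunction_rat)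
    (hX : ClassX8 W p) (h0 : W.analyticRank = 0) (hB : BSDp W p)
    {κ : ZpExtension ℚ p} {γ : absoluteGaloisGroup ℚ} (hκ : κ.IsCyclotomic)
    (hγ : κ.IsTopGenerator γ) (hγ' : IsCyclotomicVariable p γ)
    {v : HeightOneSpectrum (𝓞 ℚ)} (hv : (p : 𝓞 ℚ) ∈ v.asIdeal)
    {g : absoluteGaloisGroup (v.adicCompletion ℚ)}
    (hg : κ.IsTopGenerator (resGalOfEmb (closureEmb (K := ℚ) (v.adicCompletion ℚ)) g))
    {cneg : localPoints W (v.adicCompletion ℚ)} {c : ℕ → localPoints W (v.adicCompletion ℚ)}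
    (hc : IsHondaSystem κ (closureEmb (K := ℚ) (v.adicCompletion ℚ)) W (W.frobeniusTrace p) g cneg c)
    {N : ℕ} [NeZero N] {f : CuspForm (Gamma0 N) 2} (hf : IsNewformOf W f)
    {ϖ : ℚ} (hϖ : (ϖ : ℝ) * W.realPeriodRat = plusPeriod f)
    {Lsharp Lflat : IwasawaAlgebra p} (hSP : IsSprungPair f p (W.frobeniusTrace p) Lsharp Lflat)
    (I : IwasawaH1Data W p κ γ)
    (Cs : SharpFlatColemanKatoDataContra W p f ϖ κ γ (closureEmb (K := ℚ) (v.adicCompletion ℚ))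
      (W.frobeniusTrace p) g c Chroma.sharp I)
    (Cf : SharpFlatColemanKatoDataContra W p f ϖ κ γ (closureEmb (K := ℚ) (v.adicCompletion ℚ))
      (W.frobeniusTrace p) g c Chroma.flat I)
    (hZ : Cs.Z = Cf.Z) (Y : W.FineSelmerDualData κ γ⁻¹) (𝔭 : PrimeSpectrum (IwasawaAlgebra p))
    (h𝔭 : 𝔭.asIdeal.height = 1) :
    Module.lengthAt (IwasawaAlgebra p) (I.H ⧸ Cs.Z) 𝔭 ≤ Module.lengthAt (IwasawaAlgebra p) Y.X 𝔭 := by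
  have hN : NeZero N := inferInstance
  -- THEOREM B: the unit-content colour `•₀`
  obtain ⟨col₀, -, -, hu, -⟩ :=
    PrintX8VSOneColourMuAnX8.ClassX8.oneColourMuAn W p hX N hN f Lsharp Lflat hf hSP
  cases col₀ with
  | sharp =>
    exact (X8.katoFineLengthAt_eq_of_bsdp_of_hasUnitContent_of_analyticRank_eq_zero W p h714 h716c hCKc h59 h3 hGZK hmod hX
      h0 hB hκ hγ hγ' hv hg hc hf hϖ hSP Chroma.sharp hu I Cs Y 𝔭 h𝔭).le
  | flat =>
    rw [hZ]
    exact (X8.katoFineLengthAt_eq_of_bsdp_of_hasUnitContent_of_analyticRank_eq_zero W p h714 h716c hCKc h59 h3 hGZK hmod hX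
      h0 hB hκ hγ hγ' hv hg hc hf hϖ hSP Chroma.flat hu I Cf Y 𝔭 h𝔭).le

/-! ### §3 The conclusion shape of crux C′ (item 23733) AT a rank-zero pair with `BSD(E,3)`, unit-content colour -/

omit [ContinuousSMul ℤ_[p] (W.tateModule p)] [Module.Free ℤ_[p] (W.tateModule p)]
  [Module.Finite ℤ_[p] (W.tateModule p)] in
/-- **X8 ∧ `r_an = 0` ∧ `BSD(E,3)`, ANY image ⟹ C′'s displayed inequality `ℓ_𝔭 Λ/(G) ≤ ℓ_𝔭 D.X` at EVERY height-one `𝔭`**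
for every print-keyed dual `D` of `Sel^{•}(E/ℚ_∞)`, `•` of UNIT CONTENT, and every Néron-normalised generator `G`
(`ι G = ϖ·ι L^•`) — indeed with equality: `char D.X = (gen)`, `ι gen = ι G` (`X8KatoConverseContra` §1), `gen = G` by
injectivity of `ι`, and the characteristic ideal pins the height-one lengths (§0). No package needed. PER PAIR;
conditional; closes nothing — C′ quantifies over ALL X8 pairs and every colour with `L^• ≠ 0` and is NOT proved.
[cite: Sprung2012, Prop. 7.19 and Main Conj. 7.21 (p. 1505)] [cite: SkinnerUrban2014, §3.1.6 (p. 20)]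
[cite: Sprung2024, §5.2 Lemmas 5.5–5.9] [cite: GreenbergLNM1716, §4 (p. 103)] -/
theorem X8.lengthAt_quotient_span_le_of_bsdp_of_hasUnitContent_of_analyticRank_eq_zero
    (h714 : thm714_sharpFlatSelmerDual_finite_torsion)
    (h716c : thm716_sharpFlatCharIdeal_divisibility_contra)
    (hCKc : thm714seq_sharpFlatColemanKato_zeta_contra)
    (h59 : lem59AllN_sharpFlatCharValue_rankZero)
    (h3 : realPeriodRat_eq_unit_mul_plusPeriod_three)
    (hGZK : rank_eq_analyticRank_of_analyticRank_le_one) (hmod : hasEntireLFunction_rat)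
    (hX : ClassX8 W p) (h0 : W.analyticRank = 0) (hB : BSDp W p)
    {κ : ZpExtension ℚ p} {γ : absoluteGaloisGroup ℚ} (hκ : κ.IsCyclotomic)
    (hγ : κ.IsTopGenerator γ) (hγ' : IsCyclotomicVariable p γ)
    {v : HeightOneSpectrum (𝓞 ℚ)} (hv : (p : 𝓞 ℚ) ∈ v.asIdeal)
    {g : absoluteGaloisGroup (v.adicCompletion ℚ)}
    (hg : κ.IsTopGenerator (resGalOfEmb (closureEmb (K := ℚ) (v.adicCompletion ℚ)) g))
    {cneg : localPoints W (v.adicCompletion ℚ)} {c : ℕ → localPoints W (v.adicCompletion ℚ)}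
    (hc : IsHondaSystem κ (closureEmb (K := ℚ) (v.adicCompletion ℚ)) W (W.frobeniusTrace p) g cneg c)
    {N : ℕ} [NeZero N] {f : CuspForm (Gamma0 N) 2} (hf : IsNewformOf W f)
    {ϖ : ℚ} (hϖ : (ϖ : ℝ) * W.realPeriodRat = plusPeriod f)
    {Lsharp Lflat : IwasawaAlgebra p} (hSP : IsSprungPair f p (W.frobeniusTrace p) Lsharp Lflat)
    (col : Chroma) (hu : HasUnitContent (chromaticL col Lsharp Lflat))
    (D : SharpFlatSelmerDualData W κ γ⁻¹ (closureEmb (K := ℚ) (v.adicCompletion ℚ))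
      (W.frobeniusTrace p) g c col) [Module.Finite (IwasawaAlgebra p) D.X]
    (G : IwasawaAlgebra p)
    (hG : iwasawaToPowerSeries p G = PowerSeries.C (ϖ : ℚ_[p]) * iwasawaToPowerSeries p (chromaticL col Lsharp Lflat))
    (𝔭 : PrimeSpectrum (IwasawaAlgebra p)) (h𝔭 : 𝔭.asIdeal.height = 1) :
    Module.lengthAt (IwasawaAlgebra p) (IwasawaAlgebra p ⧸ Ideal.span {G}) 𝔭 ≤
      Module.lengthAt (IwasawaAlgebra p) D.X 𝔭 := by
  obtain ⟨hDt, gen, hchar, hgen⟩ :=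
    X8KatoConverseContra.X8.sharpFlatCharIdeal_eq_contra_of_bsdp_of_hasUnitContent_of_analyticRank_eq_zero W p h714
      h716c hCKc h59 h3 hGZK hmod hX h0 hB hκ hγ hγ' hv hg hc hf hϖ hSP col hu D
  have hGgen : G = gen := iwasawaToPowerSeries_injective p (hG.trans hgen.symm)
  rw [hGgen, ← lengthAt_eq_quotient_span hDt hchar 𝔭 h𝔭]

/-! ### §4 UNIT CELLS (`ord₃ #Ш_an ≤ 0`): the K′ inequality AT THE PAIR, conditional on published facts only -/

/-- **UNIT CELLS, X8 ∧ `r_an = 0` ∧ `ord₃ #Ш_an ≤ 0`, ANY image ⟹ K′'s inequality at every height-one `𝔭`** for the joint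
packages — §2 fed with gen 4's unit-cell `BSD(E,3)` (`X8.bsdp_of_shaAn_le_of_sharpFlatKatoContra_of_analyticRank_eq_zero`; adds
`hmodf`, `h22`). On the census of open cells: the 54 rank-`0` cells with `3 ∤ #Ш_an` (all `C_ns⁺(3)`) carry NO counterexample to
K′, modulo the displayed published facts. PER PAIR; conditional; closes nothing.
[cite: Kato2004Asterisque, Conj. 12.10 (p. 224)] [cite: Sprung2012, Thm. 2.2, Thm. 7.14 (3), Prop. 7.19, Main Conj. 7.21 (pp. 1487–1505)]
[cite: Sprung2024, §5.2 Lemmas 5.5–5.9] [cite: Miller2011LMS, Def. 1.1] -/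
theorem X8.katoFineLengthAt_le_joint_of_shaAn_le_of_analyticRank_eq_zero
    (hmodf : exists_isNewformOf) (h22 : thm22_exists_isHondaSystem)
    (h714 : thm714_sharpFlatSelmerDual_finite_torsion)
    (h716c : thm716_sharpFlatCharIdeal_divisibility_contra)
    (hCKc : thm714seq_sharpFlatColemanKato_zeta_contra)
    (h59 : lem59AllN_sharpFlatCharValue_rankZero)
    (h3 : realPeriodRat_eq_unit_mul_plusPeriod_three)
    (hGZK : rank_eq_analyticRank_of_analyticRank_le_one) (hmod : hasEntireLFunction_rat)
    (hX : ClassX8 W p) (h0 : W.analyticRank = 0)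
    (hsha : ∃ q : ℚ, shaAn W = (q : ℂ) ∧ padicValRat p q ≤ 0)
    {κ : ZpExtension ℚ p} {γ : absoluteGaloisGroup ℚ} (hκ : κ.IsCyclotomic)
    (hγ : κ.IsTopGenerator γ) (hγ' : IsCyclotomicVariable p γ)
    {v : HeightOneSpectrum (𝓞 ℚ)} (hv : (p : 𝓞 ℚ) ∈ v.asIdeal)
    {g : absoluteGaloisGroup (v.adicCompletion ℚ)}
    (hg : κ.IsTopGenerator (resGalOfEmb (closureEmb (K := ℚ) (v.adicCompletion ℚ)) g))
    {cneg : localPoints W (v.adicCompletion ℚ)} {c : ℕ → localPoints W (v.adicCompletion ℚ)}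
    (hc : IsHondaSystem κ (closureEmb (K := ℚ) (v.adicCompletion ℚ)) W (W.frobeniusTrace p) g cneg c)
    {N : ℕ} [NeZero N] {f : CuspForm (Gamma0 N) 2} (hf : IsNewformOf W f)
    {ϖ : ℚ} (hϖ : (ϖ : ℝ) * W.realPeriodRat = plusPeriod f)
    {Lsharp Lflat : IwasawaAlgebra p} (hSP : IsSprungPair f p (W.frobeniusTrace p) Lsharp Lflat)
    (I : IwasawaH1Data W p κ γ)
    (Cs : SharpFlatColemanKatoDataContra W p f ϖ κ γ (closureEmb (K := ℚ) (v.adicCompletion ℚ))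
      (W.frobeniusTrace p) g c Chroma.sharp I)
    (Cf : SharpFlatColemanKatoDataContra W p f ϖ κ γ (closureEmb (K := ℚ) (v.adicCompletion ℚ))
      (W.frobeniusTrace p) g c Chroma.flat I)
    (hZ : Cs.Z = Cf.Z) (Y : W.FineSelmerDualData κ γ⁻¹) (𝔭 : PrimeSpectrum (IwasawaAlgebra p))
    (h𝔭 : 𝔭.asIdeal.height = 1) :
    Module.lengthAt (IwasawaAlgebra p) (I.H ⧸ Cs.Z) 𝔭 ≤ Module.lengthAt (IwasawaAlgebra p) Y.X 𝔭 :=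
  X8.katoFineLengthAt_le_joint_of_bsdp_of_analyticRank_eq_zero W p h714 h716c hCKc h59 h3 hGZK hmod hX h0
    (X8KatoUpperHalfContra.X8.bsdp_of_shaAn_le_of_sharpFlatKatoContra_of_analyticRank_eq_zero W p hmodf h22 h714 h716c
      hCKc h59 h3 hGZK hmod hX h0 hsha)
    hκ hγ hγ' hv hg hc hf hϖ hSP I Cs Cf hZ Y 𝔭 h𝔭

end PerPair

/-! ### §5 CLASS form: the rank-zero half of the leaf ⟹ K′'s conclusion on X8 ∩ {r_an = 0} -/

/-- **CLASS form.** If `BSDp W 3` holds at every rank-zero X8 pair (the `r_an = 0` half of `WAllCornerX8`), then at every such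
pair, for every frame / newform / period / Sprung pair / Kato datum / JOINT contragredient packages with `Cs.Z = Cf.Z` / fine
datum / height-one `𝔭`: `ℓ_𝔭(I.H ⧸ Cs.Z) ≤ ℓ_𝔭 Y′.X` — the conclusion of crux K′ (item 23732) on the rank-zero locus, modulo
the seven displayed published facts. So the rank-zero research content of K′ is carried by the rank-zero pairs where `BSD(E,3)`
is OPEN (`3 ∣ #Ш_an`: 88 of the 142 rank-`0` census cells). Conditional; closes nothing.
[cite: Kato2004Asterisque, Conj. 12.10 (p. 224)] [cite: Sprung2012, Prop. 7.19 and Main Conj. 7.21 (p. 1505)]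
[cite: GreenbergLNM1716, §4 (p. 103)] [cite: Miller2011LMS, Def. 1.1] -/
theorem X8.katoFineLowerSporadic_rankZero_of_bsdp_rankZero
    (h714 : thm714_sharpFlatSelmerDual_finite_torsion)
    (h716c : thm716_sharpFlatCharIdeal_divisibility_contra)
    (hCKc : thm714seq_sharpFlatColemanKato_zeta_contra)
    (h59 : lem59AllN_sharpFlatCharValue_rankZero)
    (h3 : realPeriodRat_eq_unit_mul_plusPeriod_three)
    (hGZK : rank_eq_analyticRank_of_analyticRank_le_one) (hmod : hasEntireLFunction_rat)
    (hBSD : ∀ (W : WeierstrassCurve ℚ) [W.IsElliptic] [W.IsGloballyMinimal] (p : ℕ) [Fact p.Prime],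
      ClassX8 W p → W.analyticRank = 0 → BSDp W p) :
    ∀ (W : WeierstrassCurve ℚ) [W.IsElliptic] [W.IsGloballyMinimal] (p : ℕ) [Fact p.Prime]
      [ContinuousSMul ℤ_[p] (W.tateModule p)] [Module.Free ℤ_[p] (W.tateModule p)]
      [Module.Finite ℤ_[p] (W.tateModule p)],
      ClassX8 W p → W.analyticRank = 0 → ∀ (κ : ZpExtension ℚ p) (γ : absoluteGaloisGroup ℚ),
      κ.IsCyclotomic → κ.IsTopGenerator γ → IsCyclotomicVariable p γ →
      ∀ (v : HeightOneSpectrum (𝓞 ℚ)), (p : 𝓞 ℚ) ∈ v.asIdeal →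
      ∀ (g : absoluteGaloisGroup (v.adicCompletion ℚ)),
      κ.IsTopGenerator (resGalOfEmb (closureEmb (K := ℚ) (v.adicCompletion ℚ)) g) →
      ∀ (cneg : localPoints W (v.adicCompletion ℚ)) (c : ℕ → localPoints W (v.adicCompletion ℚ)),
      IsHondaSystem κ (closureEmb (K := ℚ) (v.adicCompletion ℚ)) W (W.frobeniusTrace p) g cneg c →
      ∀ (N : ℕ) (_ : NeZero N) (f : CuspForm (Gamma0 N) 2) (ϖ : ℚ) (Lsharp Lflat : IwasawaAlgebra p),
      IsNewformOf W f → (ϖ : ℝ) * W.realPeriodRat = plusPeriod f → IsSprungPair f p (W.frobeniusTrace p) Lsharp Lflat →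
      ∀ (I : IwasawaH1Data W p κ γ)
        (Cs : SharpFlatColemanKatoDataContra W p f ϖ κ γ (closureEmb (K := ℚ) (v.adicCompletion ℚ))
          (W.frobeniusTrace p) g c Chroma.sharp I)
        (Cf : SharpFlatColemanKatoDataContra W p f ϖ κ γ (closureEmb (K := ℚ) (v.adicCompletion ℚ))
          (W.frobeniusTrace p) g c Chroma.flat I), Cs.Z = Cf.Z →
      ∀ (Y : W.FineSelmerDualData κ γ⁻¹) (𝔭 : PrimeSpectrum (IwasawaAlgebra p)), 𝔭.asIdeal.height = 1 →
      Module.lengthAt (IwasawaAlgebra p) (I.H ⧸ Cs.Z) 𝔭 ≤ Module.lengthAt (IwasawaAlgebra p) Y.X 𝔭 :=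
  fun W _ _ p _ _ _ _ hX h0 _κ _γ hκ hγ hγ' _v hv _g hg _cneg _c hc _N hN _f _ϖ _Ls _Lf hf hϖ hSP I Cs Cf hZ Y 𝔭 h𝔭 ↦
    haveI := hN
    X8.katoFineLengthAt_le_joint_of_bsdp_of_analyticRank_eq_zero W p h714 h716c hCKc h59 h3 hGZK hmod hX h0 (hBSD W p hX h0)
      hκ hγ hγ' hv hg hc hf hϖ hSP I Cs Cf hZ Y 𝔭 h𝔭

end Summit.BirchSwinnertonDyer.BirchSwinnertonDyer.Theorems.X8KatoConverseContraLength

end
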